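import Summits.CriticalPhenomena.PercolationContinuityZ3.Theorems.PercNearOneGluingNoHeavyLowerTailSunflowerBipartiteSafe
import HarnessLib

/-!
# `NoHeavyLowerTail` (crux stmt-CriticalPhenomena-4575), abstract sunflower cubic: the LOCAL LOAD INEQUALITY (equal-split
discharging) — a typed conjecture for triangle-free graph cores and the reduction LLI ⟹ weighted inequality ⟹ `TriangleFreeSafe`

Support file (seat `prim-ineq-prove-1` gen 41; `--supports stmt-CriticalPhenomena-4575`).  No `sorry`, no named facts.  Memo:
run/shared/lean/prim/prim-ineq-prove-1/FINDING-LLI-prove1-g41.md.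

SETTING (as in g40's `…SunflowerBipartite*` files).  Core `A`, petals `W k` (`PetalData`), a profile `m : Fin n → ℕ` and its fibre
`TypeModel.Model.confs m` of slot-set assignments `S : Fin n → Finset (Fin K)` with rows `row S k`; `J A S` = the non-A rows;
`BadG` (≥ 2 non-A rows, lying in pairwise distinct petals) and `GoodG` (exactly one non-A row, in no petal).  g40 reduced Lemma A for all
parameter vectors to the fibrewise WEIGHTED INEQUALITY `Σ_{BadG} (K − |J|)! ≤ (K−1)!·#GoodG` (`polarised_of_weighted`,
`sum_wprof_le_of_fibrewise`) and proved the latter for bipartite graphs by an explicit injection.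

THIS FILE.  The simplest conceivable transport plan: every BAD configuration `c` (mass `(K − |J c|)!`) splits its mass EQUALLY among
the GOOD configurations `g` that AGREE WITH `c` ON THE FRAME OF `c` (the rows of the A-slots of `c` are unchanged; the Z-slot of `g` is
then automatically one of the non-A slots of `c`).  `load g` is the mass received by `g`.  The LOCAL LOAD INEQUALITY `LocalLoad A W m`
says: every BAD configuration has at least one such GOOD neighbour, and every GOOD configuration receives at most `(K−1)!`.
* `weighted_of_localLoad` : `LocalLoad A W m` ⟹ the weighted inequality on the fibre `m` (double counting).
* `safe_of_weighted` : for a graph core, the weighted inequality for every number of petals, every admissible family and every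
  profile ⟹ `SafeCalc.Safe p (edgeCore Γ)` for every `p` (g40's assembly, verbatim, with the weighted inequality as a hypothesis).
* `TriangleFreeLocalLoad` (typed conjecture) : LLI holds on every fibre of every triangle-free graph core, for every family of
  up-sets meeting pairwise inside the core; `triangleFreeSafe_of_localLoad` : it implies g39's `SafeCalc.TriangleFreeSafe`.
EVIDENCE for the conjecture (exact enumeration, memo §3): all 58 triangle-free graphs on ≤ 6 vertices (K = 3, every 3-block
partition of the maximal independent sets, every profile), `C₇` (K = 3, all 712 586 fibres with a BAD configuration), `C₅` (K = 4),
random non-maximal petal systems on `C₅`/`P₅`/`2K₂`; the maximum load ratio is exactly 1 (attained on the "one edge" fibres) and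
never exceeded.  It FAILS for 3-uniform cores (`{123,456}`, `{123,345}`: ratio 1.25, 1.28) although the weighted inequality holds there,
and of course for the triangle.  The pointwise form unrolls (memo §2) to
`Σ_{S ⊆ A-slots(g), |S| ≤ K−2} |S|!·P_{K−|S|}(m − ρ_S)/G_{K−|S|}(m − ρ_S) ≤ (K−1)!`, equivalently
`P_K(m)/G_K(m) ≤ Σ_{k ∈ A-slots(g)} slack_{K−1}(g ∖ k)`; for K = 3: `P₃(m)/G₃(m) ≤ X(ρ₁)/G₂(ρ₁) + X(ρ₂)/G₂(ρ₂)` (the rainbow ratio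
of the fibre is at most the sum of the relative 2-row Kleitman excesses of the two A-rows of `g`).  LLI is open even for bipartite
graphs (g40's injection is a different, 0/1-valued transport plan).

**UPDATE (same seat, same day, after the 8-vertex census): `TriangleFreeLocalLoad` is FALSE.**  Counterexample (exact; memo
run/shared/lean/prim/prim-ineq-prove-1/LLI-COUNTEREXAMPLE-g41.md, evidence 11048 on the crux item): the BIPARTITE graph on 8 vertices
with edges 12, 17, 28, 38, 48, 58, 68 (path 7–1–2–8 plus four pendant twins of 8), K = 3, petals = blocks {13456} | {234567} | {18, 78} of
the maximal independent sets, profile m ≡ 1, GOOD configuration (ρ₁, ρ₂, ζ) = ({1,3,4,5,6,7}, {2,8}, ∅): equal-split load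
15/113 + 1 + 7/8 = 3630/1808 > 2 = (K−1)! (ratio 1815/1808); 3 of the 409 triangle-free graphs on 8 vertices violate LLI at K = 3, none on
≤ 7 vertices.  Mechanism: a one-edge Kleitman-tight residual (u₂ = 1), a residual "one edge + t free twins" (u₂ = 1 − 2^{1−t}) and a rainbow
ratio u₃ > 2^{1−t}.  The weighted inequality itself is not affected (here it is g40's theorem), and N-LOCAL transport plans (supported on
frame-agreeing pairs, like g40's Ψ) exist on every fibre tested; only the canonical equal-split plan fails.  The implications below
(`weighted_of_localLoad`, `safe_of_weighted`, `triangleFreeSafe_of_localLoad`) are unaffected as theorems; `LocalLoad A W m` remains a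
usable SUFFICIENT condition fibre by fibre (it holds, e.g., on every fibre of every triangle-free graph with ≤ 7 vertices for K = 3).
-/

namespace Summit.CriticalPhenomena.PercolationContinuityZ3.Theorems.SunflowerPartition

namespace Bridge

open Finset MeasureTheory Literature.Probability.LatticeModels Literature.Probability.Percolation

variable {K n : ℕ}

section LocalLoad

variable (A : Set (Set (Fin n))) (W : Fin K → Set (Set (Fin n))) (m : Fin n → ℕ)

/-- `g` agrees with `c` on the frame of `c`: the rows of the A-slots of `c` are unchanged. [this work] -/
def Agree (c g : Fin n → Finset (Fin K)) : Prop := ∀ k, k ∉ J A c → row g k = row c k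

open scoped Classical in
/-- The GOOD configurations of profile `m` agreeing with `c` on the frame of `c` (the GOOD neighbours of `c`). [this work] -/
noncomputable def goodOver (c : Fin n → Finset (Fin K)) : Finset (Fin n → Finset (Fin K)) :=
  (TypeModel.Model.confs m).filter fun g => GoodG A W g ∧ Agree A c g

open scoped Classical in
/-- The equal-split LOAD received by `g`: every BAD `c` whose frame `g` extends sends `(K − |J c|)! / #goodOver c`. [this work] -/
noncomputable def load (g : Fin n → Finset (Fin K)) : ℚ :=
  ∑ c ∈ (TypeModel.Model.confs m).filter (fun c => BadG A W c ∧ Agree A c g),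
    ((K - (J A c).card).factorial : ℚ) / ((goodOver A W m c).card : ℚ)

open scoped Classical in
/-- **The local load inequality on the fibre `m`**: every BAD configuration has a GOOD neighbour, and no GOOD configuration receives
more than `(K−1)!` under equal splitting. [this work] -/
def LocalLoad : Prop :=
  (∀ c ∈ TypeModel.Model.confs m, BadG A W c → 0 < (goodOver A W m c).card) ∧
  (∀ g ∈ TypeModel.Model.confs m, GoodG A W g → load A W m g ≤ ((K - 1).factorial : ℚ))

open scoped Classical in
/-- **LLI ⟹ the weighted inequality** `Σ_{BadG} (K − |J|)! ≤ (K−1)!·#GoodG` on the fibre (double counting: the total mass sent equals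
the total load received). [this work] -/
theorem weighted_of_localLoad (h : LocalLoad A W m) :
    ∑ S ∈ (TypeModel.Model.confs m).filter (fun S => BadG A W S), (K - (J A S).card).factorial ≤
      (K - 1).factorial * ((TypeModel.Model.confs m).filter fun S => GoodG A W S).card := by
  classical
  obtain ⟨hdeg, hload⟩ := h
  set C := TypeModel.Model.confs (ι := Fin n) (K := K) m with hC
  set B := C.filter fun S => BadG A W S with hB
  set G := C.filter fun S => GoodG A W S with hG
  set w : (Fin n → Finset (Fin K)) → ℚ := fun c => ((K - (J A c).card).factorial : ℚ) with hw
  set d : (Fin n → Finset (Fin K)) → ℚ := fun c => ((goodOver A W m c).card : ℚ) with hd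
  suffices hq : ∑ c ∈ B, w c ≤ ((K - 1).factorial : ℚ) * (G.card : ℚ) by
    have : ((∑ S ∈ B, (K - (J A S).card).factorial : ℕ) : ℚ) ≤ (((K - 1).factorial * G.card : ℕ) : ℚ) := by
      push_cast; exact hq
    exact_mod_cast this
  -- each BAD `c` distributes its mass over its GOOD neighbours
  have hgood : ∀ c, goodOver A W m c = G.filter fun g => Agree A c g := by
    intro c; simp only [goodOver, hG, hC, Finset.filter_filter]
  have h1 : ∀ c ∈ B, w c = ∑ g ∈ G, if Agree A c g then w c / d c else 0 := by
    intro c hc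
    have hpos : (0 : ℚ) < ((goodOver A W m c).card : ℚ) := by
      have := hdeg c (Finset.mem_filter.1 hc).1 (Finset.mem_filter.1 hc).2
      exact_mod_cast this
    rw [← Finset.sum_filter, ← hgood, Finset.sum_const, nsmul_eq_mul]
    simp only [hd]
    rw [mul_div_assoc', mul_comm, mul_div_assoc, div_self hpos.ne', mul_one]
  -- each GOOD `g` collects its load
  have h2 : ∀ g ∈ G, (∑ c ∈ B, if Agree A c g then w c / d c else 0) = load A W m g := by
    intro g _
    simp only [load, hB, Finset.sum_filter, hw, hd]
    refine Finset.sum_congr rfl fun c _ => ?_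
    by_cases hb : BadG A W c <;> by_cases ha : Agree A c g <;> simp [hb, ha]
  calc ∑ c ∈ B, w c = ∑ c ∈ B, ∑ g ∈ G, if Agree A c g then w c / d c else 0 := Finset.sum_congr rfl h1
    _ = ∑ g ∈ G, ∑ c ∈ B, if Agree A c g then w c / d c else 0 := Finset.sum_comm
    _ = ∑ g ∈ G, load A W m g := Finset.sum_congr rfl h2
    _ ≤ ∑ g ∈ G, ((K - 1).factorial : ℚ) :=
        Finset.sum_le_sum fun g hg => hload g (Finset.mem_filter.1 hg).1 (Finset.mem_filter.1 hg).2
    _ = ((K - 1).factorial : ℚ) * (G.card : ℚ) := by rw [Finset.sum_const, nsmul_eq_mul, mul_comm]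

end LocalLoad

/-! ### Assembly: fibrewise weighted inequalities ⟹ safety of a graph core (g40's argument with the weighted inequality as input) -/

open scoped Classical in
/-- If the weighted inequality `Σ_{BadG} (K − |J|)! ≤ (K−1)!·#GoodG` holds on every profile fibre, for every number `K` of petals and
every family of up-sets meeting pairwise inside the graph core, then the core is safe for every parameter vector.  (Polarisation of
both sides, `sum_wprof_le_of_fibrewise`, `polarised_of_weighted` — g40's assembly.) [this work] -/
theorem safe_of_weighted (Γ : SimpleGraph (Fin n)) (p : Fin n → unitInterval)
    (hw : ∀ (K : ℕ) (V : Fin K → Set (Set (Fin n))), (∀ k, IsUpperSet (V k)) →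
      (∀ i j, i ≠ j → V i ∩ V j ⊆ SafeCalc.edgeCore Γ) → ∀ m : Fin n → ℕ,
      ∑ S ∈ (TypeModel.Model.confs m).filter (fun S => BadG (SafeCalc.edgeCore Γ) (Wof Γ V) S),
          (K - (J (SafeCalc.edgeCore Γ) S).card).factorial ≤
        (K - 1).factorial * ((TypeModel.Model.confs m).filter fun S => GoodG (SafeCalc.edgeCore Γ) (Wof Γ V) S).card) :
    SafeCalc.Safe p (SafeCalc.edgeCore Γ) := by
  classical
  intro K V hV hcap
  set A := SafeCalc.edgeCore Γ with hA
  rcases Nat.eq_zero_or_pos K with hK | hK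
  · subst hK; simp
  set last : Fin K := ⟨K - 1, by omega⟩ with hlast
  have hPD : PetalData A (Wof Γ V) := petalData_Wof Γ V hcap
  rw [prod_real_eq_sum_wprof p V]
  set V'' : Fin K → Set (Set (Fin n)) := fun k => if k = last then Set.univ else A with hV''
  have hrhs : ((prodBernoulli p).real A) ^ (K - 1) = ∏ k, (prodBernoulli p).real (V'' k) := by
    have e : (fun k => (prodBernoulli p).real (V'' k)) =
        fun k => if k = last then (prodBernoulli p).real (Set.univ : Set (Set (Fin n))) else (prodBernoulli p).real A := by
      funext k; by_cases hk : k = last <;> simp [hV'', hk]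
    rw [e, Finset.prod_ite, Finset.prod_const, Finset.prod_const, probReal_univ, one_pow, one_mul]
    congr 1
    have : (Finset.univ.filter fun k : Fin K => ¬ k = last) = Finset.univ.erase last := by
      ext k; simp
    rw [this, Finset.card_erase_of_mem (Finset.mem_univ _), Finset.card_univ, Fintype.card_fin]
  rw [hrhs, prod_real_eq_sum_wprof p V'']
  have hQ : ∀ S : Fin n → Finset (Fin K), (∀ k, row S k ∈ V'' k) ↔ (∀ k, k ≠ last → row S k ∈ A) := by
    intro S
    refine forall_congr' fun k => ?_
    by_cases hk : k = last <;> simp [hV'', hk]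
  simp_rw [hQ]
  refine sum_wprof_le_of_fibrewise p _ _ fun m => ?_
  calc ((TypeModel.Model.confs m).filter fun S => ∀ k, row S k ∈ V k).card
      ≤ ((TypeModel.Model.confs m).filter fun S => ∀ k, row S k ∈ A ∪ Wof Γ V k).card := by
        refine Finset.card_le_card (Finset.monotone_filter_right _ fun S _ h k => ?_)
        by_cases hkA : row S k ∈ A
        · exact Or.inl hkA
        · exact Or.inr ⟨h k, hkA⟩
    _ ≤ ((TypeModel.Model.confs m).filter fun S => ∀ k, k ≠ last → row S k ∈ A).card := by
        have hw' := hw K V hV hcap m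
        convert polarised_of_weighted hPD m last (by convert hw' using 2) using 2

/-! ### The typed conjecture and its consequence -/

/-- **REFUTED ex-conjecture (kept as a named statement): the LOCAL LOAD INEQUALITY for triangle-free graph cores.**  For every
triangle-free graph `Γ`, every family of up-sets `V k` meeting pairwise inside `edgeCore Γ` and every profile `m`, equal-split discharging
from BAD to GOOD configurations loads every GOOD configuration by at most `(K−1)!` (`LocalLoad`).  TRUE on every fibre of every
triangle-free graph with ≤ 7 vertices (K = 3, exact census) and FALSE at 8 vertices: the bipartite graph with edges 12,17,28,38,48,58,68,
K = 3, blocks {13456}|{234567}|{18,78}, m ≡ 1, g = ({1,3,4,5,6,7},{2,8},∅) has load 3630/1808 > 2 (see the module docstring; memo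
LLI-COUNTEREXAMPLE-g41.md).  Never used as a fact; `triangleFreeSafe_of_localLoad` records only the (valid) implication. [this work] -/
def TriangleFreeLocalLoad : Prop :=
  ∀ (n : ℕ) (Γ : SimpleGraph (Fin n)), Γ.CliqueFree 3 → ∀ (K : ℕ) (V : Fin K → Set (Set (Fin n))),
    (∀ k, IsUpperSet (V k)) → (∀ i j, i ≠ j → V i ∩ V j ⊆ SafeCalc.edgeCore Γ) →
    ∀ m : Fin n → ℕ, LocalLoad (SafeCalc.edgeCore Γ) (Wof Γ V) m

/-- **LLI ⟹ G△ (valid implication; the hypothesis is now known to be false as a universal statement, see above).**  The local load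
inequality for triangle-free graph cores implies g39's conjecture `SafeCalc.TriangleFreeSafe` (every triangle-free graph core is A-safe).
[this work] -/
theorem triangleFreeSafe_of_localLoad (h : TriangleFreeLocalLoad) : SafeCalc.TriangleFreeSafe :=
  fun n Γ hΓ p => safe_of_weighted Γ p fun K V hV hcap m => weighted_of_localLoad _ _ m (h n Γ hΓ K V hV hcap m)

end Bridge

end Summit.CriticalPhenomena.PercolationContinuityZ3.Theorems.SunflowerPartition
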